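import Summits.CriticalPhenomena.PercolationContinuityZ3.Theorems.PercTreeValueTetrahedronLogConvexityTransfer
import Summits.CriticalPhenomena.PercolationContinuityZ3.Theorems.PercTreeValueAssemblyViaLogConvexity
import Summits.CriticalPhenomena.PercolationContinuityZ3.Theorems.PercTreeValueConnectionPatternFactorisation

/-!
# `TetrahedronLogConvexity` (stmt-CriticalPhenomena-7801), line `Sketch` — the STRENGTH of the one open stub

The registered skeleton `Cruxes/TetrahedronLogConvexity/Lines/Sketch.lean` (certificate form of the card
`mirror-certificate-vigour`) closes the crux modulo ONE stub, `stub_certificate`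
((V) vigour ∧ (L) lopsidedness of the mirror-symmetric two-seed certificate with `η < 2v`), equivalently modulo a
uniform Harris gap `κ > 1` on the certificate's continuation (`tetrahedronLogConvexity_of_certHarrisGap`,
`tetrahedronLogConvexity_of_certificate`, file `…Transfer.lean`).

This file records, as tree theorems, how strong that residual stub is:

* `percolationContinuityZ3_of_certHarrisGap`, `percolationContinuityZ3_of_certificate` — either form of the stub
  already implies the whole conjunct `PercolationContinuityZ3` (`θ(p_c) = 0` on `ℤ³`): transfer (this line) ∘
  `AssemblyViaLogConvexity` (stmt-CriticalPhenomena-7805) ∘ `ConnectionPatternFactorisation` (stmt-CriticalPhenomena-7802),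
  all landed. So the stub is not a lemma-sized residue: any proof of it is a proof of the sub-problem.
* `not_certHarrisGap_of_theta_ne_zero`, `not_certificate_of_theta_ne_zero` — contrapositively, in a jump world
  (`θ(p_c) ≠ 0`) both forms are FALSE. Every tool the line leans on (Harris–FKG on the continuation, the strong
  Markov property of the stopping set, truncation removal, the lattice mirror, Cauchy–Schwarz) is valid verbatim
  in a jump world; hence no argument built from those tools alone can prove the stub — a proof must use an input
  that fails when `θ(p_c) > 0`.

Pure glue; nothing here is conditional on an unproved named fact.
-/

noncomputable section

open MeasureTheory Filter
open Literature.Probability.Percolation Literature.Probability.LatticeModels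

namespace Summit.CriticalPhenomena.PercolationContinuityZ3.Theorems.TetrahedronLogConvexity.Cert

/-- **The Harris-gap stub implies the conjunct.** A uniform Harris gap `κ > 1` on the continuation of the
two-seed certificate (`κ · Qb(r,R)² ≤ τ(0,a_r) · Qbc(r,R)` for all large `r`, then all large `R`) implies
`θ(p_c) = 0` on `ℤ³`: it gives `TetrahedronLogConvexity` (`tetrahedronLogConvexity_of_certHarrisGap`), which with
pattern-blindness of a jump (`connectionPatternFactorisation_proof`) closes `AssemblyViaLogConvexity`
(`percTreeValue_assemblyViaLogConvexity_proof`). [folklore] -/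
theorem percolationContinuityZ3_of_certHarrisGap :
    (∃ κ : ℝ, 1 < κ ∧ ∃ r₀ : ℕ, ∀ r : ℕ, r₀ ≤ r → ∃ R₀ : ℕ, ∀ R : ℕ, R₀ ≤ R →
      κ * Qb r R ^ 2 ≤ tau 3 (criticalProbI 3) 0 (vA r) * Qbc r R) →
    _root_.PercolationContinuityZ3 :=
  fun h => percTreeValue_assemblyViaLogConvexity_proof connectionPatternFactorisation_proof
    (tetrahedronLogConvexity_of_certHarrisGap h)

/-- **The (V)∧(L) stub implies the conjunct.** The registered stub `stub_certificate` of line `Sketch`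
((V) `2(1+v)·Qb² ≤ τ(0,a_r)·(Qbc + Qbb)` and (L) `Qbb ≤ (1+η)·Qbc` eventually, with `0 ≤ η < 2v`), taken as a
hypothesis, implies `θ(p_c) = 0` on `ℤ³` (transfer `tetrahedronLogConvexity_of_certificate`, then the landed
assembly and factorisation). [folklore] -/
theorem percolationContinuityZ3_of_certificate :
    (∃ v η : ℝ, 0 ≤ η ∧ η < 2 * v ∧ ∃ r₀ : ℕ, ∀ r : ℕ, r₀ ≤ r → ∃ R₀ : ℕ, ∀ R : ℕ, R₀ ≤ R →
      2 * (1 + v) * Qb r R ^ 2 ≤ tau 3 (criticalProbI 3) 0 (vA r) * (Qbc r R + Qbb r R) ∧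
      Qbb r R ≤ (1 + η) * Qbc r R) →
    _root_.PercolationContinuityZ3 :=
  fun h => percTreeValue_assemblyViaLogConvexity_proof connectionPatternFactorisation_proof
    (tetrahedronLogConvexity_of_certificate h)

/-- **A jump kills the Harris-gap stub.** If `θ(p_c) ≠ 0` on `ℤ³` then there is NO uniform Harris gap `κ > 1`
on the certificate's continuation (contrapositive of `percolationContinuityZ3_of_certHarrisGap`): in a jump
world the launching powers of the pinned certificate self-average and the Harris step is asymptotically an
equality. [folklore] -/
theorem not_certHarrisGap_of_theta_ne_zero :
    theta (zdGraph 3) (0 : Site 3) (criticalProbI 3) ≠ 0 →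
    ¬ ∃ κ : ℝ, 1 < κ ∧ ∃ r₀ : ℕ, ∀ r : ℕ, r₀ ≤ r → ∃ R₀ : ℕ, ∀ R : ℕ, R₀ ≤ R →
      κ * Qb r R ^ 2 ≤ tau 3 (criticalProbI 3) 0 (vA r) * Qbc r R :=
  fun hθ h => hθ (percolationContinuityZ3_iff.mp (percolationContinuityZ3_of_certHarrisGap h))

/-- **A jump kills the (V)∧(L) stub.** If `θ(p_c) ≠ 0` on `ℤ³` then the registered stub `stub_certificate`
of line `Sketch` is false (contrapositive of `percolationContinuityZ3_of_certificate`). [folklore] -/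
theorem not_certificate_of_theta_ne_zero :
    theta (zdGraph 3) (0 : Site 3) (criticalProbI 3) ≠ 0 →
    ¬ ∃ v η : ℝ, 0 ≤ η ∧ η < 2 * v ∧ ∃ r₀ : ℕ, ∀ r : ℕ, r₀ ≤ r → ∃ R₀ : ℕ, ∀ R : ℕ, R₀ ≤ R →
      2 * (1 + v) * Qb r R ^ 2 ≤ tau 3 (criticalProbI 3) 0 (vA r) * (Qbc r R + Qbb r R) ∧
      Qbb r R ≤ (1 + η) * Qbc r R :=
  fun hθ h => hθ (percolationContinuityZ3_iff.mp (percolationContinuityZ3_of_certificate h))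

end Summit.CriticalPhenomena.PercolationContinuityZ3.Theorems.TetrahedronLogConvexity.Cert
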